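import Literature.NumberTheory.EllipticCurves.TwoIsogenyDescentAlpha
import HarnessLib

/-!
# The local image of the `2`-isogeny Kummer map at a place where the other two `2`-torsion points collide
# (`y² = x((x - c)² - e)`, `c` a unit, `e` in the maximal ideal) and at a dyadic place of depth `≥ 17`

Topic `NumberTheory/EllipticCurves`. For `W : y² = x³ + ax² + bx` in two-torsion normal form over a field `L` with a
`ℤᵐ⁰`-valued valuation `v` (e.g. a completion `K_v` of a number field), write `x² + ax + b = (x - c)² - e`
(`a = -2c`, `b = c² - e`). When `c` is a `v`-UNIT and `e ∈ 𝔪_v` (the two `2`-torsion points other than `T = (0,0)`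
collide modulo `v`: multiplicative reduction with `T` on the identity component), the `x`-coordinate square-class map
`α : W(L) → Lˣ/Lˣ²` (`WeierstrassCurve.xSqClass`, Silverman–Tate §3.5) takes values in the two cosets
`(1 + 𝔪_v)Lˣ²` and `c(1 + 𝔪_v)Lˣ²` only, and in the first one alone when `ord_v(e)` is odd:

* `xSqClass_eq_sqClass_one_add_or` — **`α(P) ∈ {[1 + m], [c(1 + m)] : m ∈ 𝔪_v}`** for every `P ∈ W(L)`:
  `α(O) = 1`; `α(T) = [c² - e] = [1 - e/c²]`; for `P = (x, y)`, `x ≠ 0`, with `w = x - c`: if `v(e) < v(w²)` then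
  `y² = x w² (1 - e/w²)` gives `[x] = [1 - e/w²]`, else `w ∈ 𝔪_v` and `x = c(1 + w/c)`.
* `xSqClass_eq_sqClass_one_add_of_odd` — **if `ord_v(e)` is odd then `α(P) ∈ {[1 + m]}`**: in the remaining case
  `v(w²) ≤ v(e)` one has `v(y²) = v(x) v(w² - e) = v(e)` of odd order (or `v(w²) = v(e)`, even = odd), impossible.
* `xSqClass_eq_sqClass_one_add_eight_mul` — **the dyadic analogue**: if `v(2) < 1`, `a ≡ -2 (mod 2⁴)`,
  `a² - 4b ≡ 0 (mod 2¹⁷)`, `b ≡ 1 (mod 2³)` (as `v`-inequalities), then `α(P) ∈ {[1 + 8m] : v(m) ≤ 1}` for every `P`: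
  with `z = 2x + a`, `4y² = x(z² - (a² - 4b))`; if `v(2⁷) ≤ v(z)` then `(a² - 4b)/z² ∈ 8𝒪_v` and
  `[x] = [1 - (a² - 4b)/z²]`; otherwise `x - 1 = (z - (a + 2))/2 ∈ 8𝒪_v`.

These are the elementary local computations behind "the image of the connecting map at a place of multiplicative
reduction is generated by the class of the tangent slope" (cf. Silverman, *AEC*, Prop. X.4.9 and the proof of
Thm. X.1.1 / Ex. 10.19); they are used to KILL Selmer candidates over a number field `K ≠ ℚ` directly in `K_v` (tree
`TwoIsogenySelmerGroupShaNF`), where no explicit model of `K_v` is needed: combined with a residue map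
`𝒪_v → 𝓞 K/v` they turn the local condition `[d]_v ∈ α(W(K_v))` into a congruence on `d`. Theorems only; no named
facts, no definitions.

## References
* [SilvermanAEC2009] J. H. Silverman, *The Arithmetic of Elliptic Curves*, 2nd ed. (2009), Prop. X.4.9 (the map `α` and
  its local images), §VII.5 (points at places of multiplicative reduction).
* [SilvermanTate2015] J. H. Silverman, J. Tate, *Rational Points on Elliptic Curves*, 2nd ed. (2015), §3.5 (the map `α`).
-/

noncomputable section

open scoped Classical

namespace WeierstrassCurve

open _root_.WeierstrassCurve.Affine

variable {L : Type*} [Field L] (v : Valuation L (WithZero (Multiplicative ℤ))) (W : WeierstrassCurve L)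
  [W.IsTwoTorsionNF]

omit [W.IsTwoTorsionNF] in
/-- Square classes with square product agree: `a b = z²`, `a, b ≠ 0` ⟹ `[a] = [b]` in `Lˣ/Lˣ²` (the bookkeeping of
Silverman–Tate §3.5, "modulo squares"; stated in `namespace WeierstrassCurve`, the home of `xSqClass`).
[cite: SilvermanTate2015, §3.5] -/
theorem sqClass_eq_sqClass_of_mul_eq_sq {a b z : L} (ha : a ≠ 0) (hb : b ≠ 0) (h : a * b = z ^ 2) :
    sqClass a = sqClass b := by
  have h1 : sqClass a * sqClass b = 1 := by rw [← sqClass_mul ha hb, h, sqClass_sq]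
  calc sqClass a = sqClass a * (sqClass b * sqClass b) := by
        rw [SqUnits.mul_self]; exact (SqUnits.mul_one _).symm
    _ = sqClass b := by rw [← mul_assoc, h1]; exact SqUnits.one_mul _

omit [W.IsTwoTorsionNF] in
/-- `[t² s] = [s]` for `t, s ≠ 0` ("modulo squares", Silverman–Tate §3.5). [cite: SilvermanTate2015, §3.5] -/
theorem sqClass_sq_mul {t s : L} (ht : t ≠ 0) (hs : s ≠ 0) : sqClass (t ^ 2 * s) = sqClass s := by
  rw [sqClass_mul (pow_ne_zero 2 ht) hs, sqClass_sq]; exact SqUnits.one_mul _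

omit [W.IsTwoTorsionNF] in
/-- `1 + m` is a `v`-unit, hence non-zero, for `m ∈ 𝔪_v`. [folklore] -/
private theorem one_add_ne_zero_of_valuation_lt_one {m : L} (hm : v m < 1) : 1 + m ≠ 0 := by
  intro h0
  have h1 : v (1 + m) = 1 := by rw [v.map_add_eq_of_lt_left (by rwa [map_one]), map_one]
  rw [h0, map_zero] at h1
  exact zero_ne_one h1

/-! ## §1 The nodal case: `c` a unit, `e ∈ 𝔪_v` -/

section Node

variable {v W}
variable {c e : L} (ha : W.a₂ = -2 * c) (hb : W.a₄ = c ^ 2 - e) (hc : v c = 1) (he : v e < 1)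
include ha hb hc he

/-- **`α(P) ∈ {[1 + m]} ∪ {[c(1 + m)]}` at a nodal place.** For `W : y² = x³ + ax² + bx` with `a = -2c`,
`b = c² - e`, `v(c) = 1`, `v(e) < 1`: every `P ∈ W(L)` has `α(P) = [1 + m]` or `α(P) = [c(1 + m)]` for some `m` with
`v(m) < 1` (`α(O) = [1]`, `α(T) = [1 - e/c²]`; for `x ≠ 0`, `w = x - c`: `[x] = [1 - e/w²]` if `v(e) < v(w²)`, else
`x = c(1 + w/c)` with `w ∈ 𝔪_v`). [cite: SilvermanAEC2009, Prop. X.4.9] -/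
theorem xSqClass_eq_sqClass_one_add_or (P : W.toAffine.Point) :
    (∃ m : L, v m < 1 ∧ W.xSqClass P = sqClass (1 + m)) ∨
      ∃ m : L, v m < 1 ∧ W.xSqClass P = sqClass (c * (1 + m)) := by
  have hc0 : c ≠ 0 := fun h => by rw [h, map_zero] at hc; exact zero_ne_one hc
  rcases P with _ | ⟨x, y, hxy⟩
  · refine Or.inl ⟨0, by rw [map_zero]; exact zero_lt_one, ?_⟩
    rw [← Affine.Point.zero_def, xSqClass_zero, add_zero]
    exact ((sqClass_eq_one_iff one_ne_zero).mpr ⟨1, by ring⟩).symm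
  · by_cases hx : x = 0
    · -- `T`: `[b] = [c²(1 - e/c²)] = [1 - e/c²]`
      have hm : v (-(e / c ^ 2)) < 1 := by
        rw [Valuation.map_neg, map_div₀, map_pow, hc, one_pow, div_one]; exact he
      refine Or.inl ⟨-(e / c ^ 2), hm, ?_⟩
      rw [xSqClass_some_of_eq_zero hxy hx, hb,
        show c ^ 2 - e = c ^ 2 * (1 + -(e / c ^ 2)) by field_simp; ring]
      exact sqClass_sq_mul hc0 (one_add_ne_zero_of_valuation_lt_one v hm)
    · have heq : y ^ 2 = x * ((x - c) ^ 2 - e) := by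
        have h := (W.equation_iff_of_isTwoTorsionNF x y).mp hxy.1
        rw [ha, hb] at h; linear_combination h
      rw [xSqClass_some_of_ne_zero hxy hx]
      generalize hw : x - c = w at heq
      by_cases hcase : v e < v (w ^ 2)
      · -- `[x] = [1 - e/w²]`
        have hw0 : w ≠ 0 := by
          intro h0; rw [h0, zero_pow two_ne_zero, map_zero] at hcase; exact (not_le.mpr hcase) zero_le
        have hm : v (-(e / w ^ 2)) < 1 := by
          rw [Valuation.map_neg, map_div₀]
          exact (div_lt_one₀ (lt_of_le_of_lt zero_le hcase)).mpr hcase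
        refine Or.inl ⟨-(e / w ^ 2), hm, ?_⟩
        refine sqClass_eq_sqClass_of_mul_eq_sq hx (one_add_ne_zero_of_valuation_lt_one v hm) (z := y / w) ?_
        calc x * (1 + -(e / w ^ 2)) = x * (w ^ 2 - e) / w ^ 2 := by field_simp; ring
          _ = (y / w) ^ 2 := by rw [← heq, div_pow]
      · -- `w ∈ 𝔪_v`, `x = c(1 + w/c)`
        have hw1 : v w < 1 := by
          by_contra hge
          push Not at hge hcase
          have h2 : (1 : WithZero (Multiplicative ℤ)) ≤ v (w ^ 2) := by
            rw [map_pow]; exact one_le_pow₀ hge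
          exact absurd (lt_of_lt_of_le he h2) (not_lt.mpr hcase)
        refine Or.inr ⟨w / c, by rw [map_div₀, hc, div_one]; exact hw1, ?_⟩
        congr 1
        rw [← hw]; field_simp; ring

/-- **`α(P) ∈ {[1 + m]}` at a nodal place when `ord_v(e)` is odd** (then the tangent class is not hit: a point with
`x - c ∈ 𝔪_v` and `v((x - c)²) ≤ v(e)` would have `v(y²) = v(e)` of odd order, or `v((x - c)²) = v(e)`).
[cite: SilvermanAEC2009, Prop. X.4.9] -/
theorem xSqClass_eq_sqClass_one_add_of_odd (hodd : ¬ (2 : ℤ) ∣ WithZero.log (v e)) (P : W.toAffine.Point) :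
    ∃ m : L, v m < 1 ∧ W.xSqClass P = sqClass (1 + m) := by
  have hc0 : c ≠ 0 := fun h => by rw [h, map_zero] at hc; exact zero_ne_one hc
  have he0 : e ≠ 0 := by
    intro h0; apply hodd; rw [h0, map_zero, WithZero.log_zero]; exact dvd_zero 2
  have hve0 : v e ≠ 0 := (Valuation.ne_zero_iff v).mpr he0
  rcases P with _ | ⟨x, y, hxy⟩
  · refine ⟨0, by rw [map_zero]; exact zero_lt_one, ?_⟩
    rw [← Affine.Point.zero_def, xSqClass_zero, add_zero]
    exact ((sqClass_eq_one_iff one_ne_zero).mpr ⟨1, by ring⟩).symm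
  · by_cases hx : x = 0
    · have hm : v (-(e / c ^ 2)) < 1 := by
        rw [Valuation.map_neg, map_div₀, map_pow, hc, one_pow, div_one]; exact he
      refine ⟨-(e / c ^ 2), hm, ?_⟩
      rw [xSqClass_some_of_eq_zero hxy hx, hb,
        show c ^ 2 - e = c ^ 2 * (1 + -(e / c ^ 2)) by field_simp; ring]
      exact sqClass_sq_mul hc0 (one_add_ne_zero_of_valuation_lt_one v hm)
    · have heq : y ^ 2 = x * ((x - c) ^ 2 - e) := by
        have h := (W.equation_iff_of_isTwoTorsionNF x y).mp hxy.1
        rw [ha, hb] at h; linear_combination h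
      rw [xSqClass_some_of_ne_zero hxy hx]
      generalize hw : x - c = w at heq
      by_cases hcase : v e < v (w ^ 2)
      · have hw0 : w ≠ 0 := by
          intro h0; rw [h0, zero_pow two_ne_zero, map_zero] at hcase; exact (not_le.mpr hcase) zero_le
        have hm : v (-(e / w ^ 2)) < 1 := by
          rw [Valuation.map_neg, map_div₀]
          exact (div_lt_one₀ (lt_of_le_of_lt zero_le hcase)).mpr hcase
        refine ⟨-(e / w ^ 2), hm, ?_⟩
        refine sqClass_eq_sqClass_of_mul_eq_sq hx (one_add_ne_zero_of_valuation_lt_one v hm) (z := y / w) ?_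
        calc x * (1 + -(e / w ^ 2)) = x * (w ^ 2 - e) / w ^ 2 := by field_simp; ring
          _ = (y / w) ^ 2 := by rw [← heq, div_pow]
      · exfalso
        push Not at hcase
        -- `w ∈ 𝔪_v`, so `x = c + w` is a unit
        have hw1 : v w < 1 := by
          by_contra hge
          push Not at hge
          have h2 : (1 : WithZero (Multiplicative ℤ)) ≤ v (w ^ 2) := by
            rw [map_pow]; exact one_le_pow₀ hge
          exact absurd (lt_of_lt_of_le he h2) (not_lt.mpr hcase)
        have hvx : v x = 1 := by
          rw [show x = c + w by rw [← hw]; ring, v.map_add_eq_of_lt_left (by rw [hc]; exact hw1), hc]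
        rcases hcase.lt_or_eq with hlt | heqv
        · -- `v(w² - e) = v(e)`, so `v(y)² = v(e)` has even order
          have hvu : v (w ^ 2 - e) = v e := by
            rw [sub_eq_add_neg, v.map_add_eq_of_lt_right (by rw [Valuation.map_neg]; exact hlt),
              Valuation.map_neg]
          have hy0 : y ≠ 0 := by
            intro h0
            rw [h0, zero_pow two_ne_zero, eq_comm, mul_eq_zero] at heq
            rcases heq with h | h
            · exact hx h
            · rw [h, map_zero] at hvu; exact hve0 hvu.symm
          have key : v y ^ 2 = v e := by rw [← map_pow, heq, map_mul, hvx, one_mul, hvu]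
          have hvy : v y ≠ 0 := (Valuation.ne_zero_iff v).mpr hy0
          have hlog := congrArg WithZero.log key
          rw [WithZero.log_pow, nsmul_eq_mul] at hlog
          push_cast at hlog
          exact hodd ⟨WithZero.log (v y), by linarith⟩
        · -- `v(w²) = v(e)`: even = odd
          have hlog := congrArg WithZero.log heqv
          rw [map_pow, WithZero.log_pow, nsmul_eq_mul] at hlog
          push_cast at hlog
          exact hodd ⟨WithZero.log (v w), by linarith⟩

end Node

/-! ## §2 The dyadic case of depth `≥ 17` -/

section Dyadic

variable {v W}

/-- **`α(P) ∈ {[1 + 8m] : m ∈ 𝒪_v}` at a deep dyadic place.** For `W : y² = x³ + ax² + bx` over `L` with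
`v(2) < 1`, `v(a + 2) ≤ v(2⁴)`, `v(a² - 4b) ≤ v(2¹⁷)`, `v(b - 1) ≤ v(2³)`: every `P ∈ W(L)` has `α(P) = [1 + 8m]`
with `v(m) ≤ 1` (`α(T) = [b]`, `b ∈ 1 + 8𝒪_v`; for `x ≠ 0` put `z = 2x + a`, so `4y² = x(z² - (a² - 4b))`: if
`v(2⁷) ≤ v(z)` then `(a² - 4b)/z² ∈ 8𝒪_v` and `[x] = [1 - (a² - 4b)/z²]`; otherwise
`x - 1 = (z - (a + 2))/2 ∈ 8𝒪_v`). At a place `v ∣ 2` of a number field with `e(v|2) = 1` this says that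
`α(W(K_v))` meets the `v`-unit classes only in the trivial class (`1 + 8𝒪_v ⊆ K_vˣ²`).
[cite: SilvermanAEC2009, Prop. X.4.9] -/
theorem xSqClass_eq_sqClass_one_add_eight_mul (h20 : (2 : L) ≠ 0) (h2 : v 2 < 1)
    (ha2 : v (W.a₂ + 2) ≤ v (2 ^ 4)) (hD : v (W.a₂ ^ 2 - 4 * W.a₄) ≤ v (2 ^ 17)) (hb1 : v (W.a₄ - 1) ≤ v (2 ^ 3))
    (P : W.toAffine.Point) : ∃ m : L, v m ≤ 1 ∧ W.xSqClass P = sqClass (1 + 8 * m) := by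
  have hv2 : 0 < v 2 := lt_of_le_of_ne zero_le ((Valuation.ne_zero_iff v).mpr h20).symm
  have hpow : ∀ n : ℕ, (2 : L) ^ n ≠ 0 := fun n => pow_ne_zero n h20
  have h8 : (8 : L) = 2 ^ 3 := by norm_num
  have h80 : (8 : L) ≠ 0 := by rw [h8]; exact hpow 3
  -- `1 + 8m` is a unit of `𝒪_v` for `v(m) ≤ 1`
  have unit8 : ∀ m : L, v m ≤ 1 → 1 + 8 * m ≠ 0 := by
    intro m hm
    refine one_add_ne_zero_of_valuation_lt_one v ?_
    rw [map_mul, h8, map_pow]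
    calc v 2 ^ 3 * v m ≤ v 2 ^ 3 * 1 := by gcongr
      _ < 1 := by rw [mul_one]; exact pow_lt_one₀ zero_le h2 three_ne_zero
  have hsq1 : sqClass (1 : L) = 1 := (sqClass_eq_one_iff one_ne_zero).mpr ⟨1, by ring⟩
  rcases P with _ | ⟨x, y, hxy⟩
  · refine ⟨0, by rw [map_zero]; exact zero_le, ?_⟩
    rw [← Affine.Point.zero_def, xSqClass_zero, mul_zero, add_zero, hsq1]
  · by_cases hx : x = 0
    · -- `T`: `[b]` with `b = 1 + 8 · (b - 1)/8`
      refine ⟨(W.a₄ - 1) / 8, ?_, ?_⟩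
      · rw [map_div₀, h8]
        exact div_le_one_of_le₀ hb1 zero_le
      · rw [xSqClass_some_of_eq_zero hxy hx]
        congr 1
        field_simp
        ring
    · have heq : 4 * y ^ 2 = x * ((2 * x + W.a₂) ^ 2 - (W.a₂ ^ 2 - 4 * W.a₄)) := by
        have h := (W.equation_iff_of_isTwoTorsionNF x y).mp hxy.1
        linear_combination 4 * h
      rw [xSqClass_some_of_ne_zero hxy hx]
      set z := 2 * x + W.a₂ with hz
      set D := W.a₂ ^ 2 - 4 * W.a₄ with hDdef
      by_cases hcase : v ((2 : L) ^ 7) ≤ v z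
      · -- `D/z² ∈ 8𝒪_v` and `[x] = [1 - D/z²]`
        have hz0 : z ≠ 0 := by
          intro h0; rw [h0, map_zero] at hcase
          exact (not_lt.mpr hcase) (by rw [map_pow]; exact pow_pos hv2 7)
        set k := D / (8 * z ^ 2) with hk
        have hvk : v k ≤ 1 := by
          rw [hk, map_div₀]
          refine div_le_one_of_le₀ ?_ zero_le
          calc v D ≤ v ((2 : L) ^ 17) := hD
            _ = v ((2 : L) ^ 3) * (v ((2 : L) ^ 7)) ^ 2 := by
                simp only [map_pow]; rw [← pow_mul, ← pow_add]
            _ ≤ v (8 : L) * (v z) ^ 2 := by rw [h8]; gcongr; exact zero_le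
            _ = v (8 * z ^ 2) := by rw [map_mul, map_pow]
        refine ⟨-k, by rw [Valuation.map_neg]; exact hvk, ?_⟩
        have hne : 1 + 8 * -k ≠ 0 := unit8 (-k) (by rw [Valuation.map_neg]; exact hvk)
        refine sqClass_eq_sqClass_of_mul_eq_sq hx hne (z := 2 * y / z) ?_
        have hkz : k * (8 * z ^ 2) = D := by rw [hk]; field_simp
        calc x * (1 + 8 * -k) = x * (z ^ 2 - k * (8 * z ^ 2)) / z ^ 2 := by field_simp; ring
          _ = (2 * y / z) ^ 2 := by rw [hkz, ← heq, div_pow]; ring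
      · -- `x - 1 = (z - (a + 2))/2 ∈ 8𝒪_v`
        push Not at hcase
        refine ⟨(x - 1) / 8, ?_, ?_⟩
        · rw [map_div₀]
          refine div_le_one_of_le₀ ?_ zero_le
          have hx1 : x - 1 = (z - (W.a₂ + 2)) / 2 := by rw [hz]; field_simp; ring
          rw [hx1, map_div₀]
          refine (div_le_iff₀ hv2).mpr ?_
          rw [h8, show v ((2 : L) ^ 3) * v 2 = v ((2 : L) ^ 4) by simp only [map_pow]; rw [← pow_succ]]
          refine le_trans (v.map_sub _ _) (max_le ?_ ha2)
          refine le_trans hcase.le ?_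
          simp only [map_pow]
          exact pow_le_pow_right_of_le_one' h2.le (by norm_num)
        · congr 1
          field_simp
          ring

end Dyadic

end WeierstrassCurve

end
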